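import Literature.AnabelianGeometry.SemiGraphs.PSCSmoothCurveGenuineCuspidal
import Literature.AnabelianGeometry.SemiGraphs.PSCSmoothCurveGenuineCuspRankLevels
import HarnessLib

/-!
# The pro-`ℓ` genuine smooth-curve origin: ALL inputs of the [CombGC] Thm. 1.6 (iii) derivation hold, with `RankStatementsHold`

Mochizuki, *A combinatorial version of the Grothendieck conjecture* [CombGC], Tohoku Math. J. **59**
(2007), §1 pp. 6–14 (Def. 1.1, Rmk. 1.1.3, Rmk. 1.1.5, Prop. 1.2, Rmk. 1.3.1, Prop. 1.5, Thm. 1.6);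
[IUTchI] Rmk. 1.2.3 (iv) p. 42. [cite: MochizukiCombGC2007, §1 pp.6-14]

PROOF-ONLY assembly (abc-iut cell, layer L3, [CombGC] non-vacuity programme; seat abc-iut-w5-d195 gen 7,
brick «SC-GENUINE-COVERING-CLOSED», part L = `PSCSmoothCurveGenuineCuspidal.lean` +
`PSCSmoothCurveGenuineCuspRankLevels.lean`).  For every prime `ℓ`, the origin `Ω_scg^{(ℓ)}` of genuine
smooth-curve data over pro-`ℓ` completions of hyperbolic punctured surface groups (one vertex `Π_v = Π`,
no nodes, genus `g`, cusp groups ANY representatives of the closed cusp inertia classes) is inhabited by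
every hyperbolic type `(g, r)` and carries JOINTLY (`exists_smoothCurveGenuineProLOrigin_allInputs_hold`):
`RestrictBDOfPSCTypeHolds`, profiniteness, **`RankStatementsHold` (F-3098: Rmk. 1.1.3 / 1.3.1 incl.
`CuspRank`)**, `SturdyCoverHolds`, `UnrVertAbOfRankHolds`, `UnrVerticialCharacterizationHolds'`,
`VertCountLeNodeCountSuccHolds`, `VertexSetCharacterizationHolds`, F-2830, F-0438, F-0459, F-0440, F-0461,
F-0443, F-1931, F-0458 — hence EVERY origin-level input of the tree's Thm. 1.6 (iii) assembly
`unrVerticialIff_holds_of_inputs'` (abc-iut-w4-d052 / -f-166), whose conclusion is then DERIVED at `Ω`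
through it (last conjunct; it agrees with the direct one-vertex proof `UnrVerticialIffHolds Ω`).
Consistency / non-vacuity evidence at genuine data with cusps and all their finite étale coverings; not the
printed theorems for all pointed stable curves; 0 definitions; nothing here takes a side on [IUTchIII]
Cor. 3.12.
-/

noncomputable section

namespace Literature.AnabelianGeometry.SemiGraphs

namespace PSCDatum

open scoped Pointwise
open Literature.GroupTheory.CombinatorialGroupTheory
open Literature.GroupTheory.CombinatorialGroupTheory.PuncturedSurfaceGroup (cuspInertia IsHyperbolicType)
open SemiGraphOfAnabelioids (IsProSigmaCompletion)
open SemiGraphOfAnabelioids.IsProSigmaCompletion (exists_isProSigmaCompletion)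

/-- **For every prime `ℓ`, the pro-`ℓ` GENUINE smooth-curve origin carries the complete [CombGC] §1 /
[IUTchI] Rmk. 1.2.3 input family, `RankStatementsHold` included, and the tree's Thm. 1.6 (iii) derivation
runs there.**  See the module docstring for the list; `Ω` is inhabited by the pro-`ℓ` smooth curve of every
hyperbolic type `(g, r)`. [cite: MochizukiCombGC2007, Thm 1.6(iii) p.13] -/
theorem exists_smoothCurveGenuineProLOrigin_allInputs_hold (ℓ : ℕ) (hℓ : ℓ.Prime) :
    ∃ Ω : PSCOrigin.{0},
      (∀ (g r : ℕ), IsHyperbolicType g r →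
        ∃ (Q : ProfiniteGrp.{0}) (ι : PuncturedSurfaceGroup g r →* Q) (G : PSCDatum Q),
          IsProSigmaCompletion {ℓ} ι ∧ Ω.IsOfPSCType G ∧ G.Sigma = {ℓ} ∧ G.graph.i = 1 ∧ G.graph.n = 0 ∧
            G.graph.r = r ∧ (∀ v, G.vertGp v = ⊤ ∧ G.genus v = g) ∧
            ∃ e : G.graph.C ≃ Fin r, ∀ c, G.cuspGp c =
              ((cuspInertia (g := g) (e c)).map ι).topologicalClosure) ∧
      RestrictBDOfPSCTypeHolds Ω ∧
      (∀ ⦃Q : Type⦄ [Group Q] [TopologicalSpace Q] [IsTopologicalGroup Q] (G : PSCDatum Q),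
        Ω.IsOfPSCType G → CompactSpace Q ∧ T2Space Q ∧ TotallyDisconnectedSpace Q ∧ IsEmpty G.graph.N ∧
          (∀ v, G.vertGp v = ⊤) ∧ (∃ v₀ : G.graph.V, ∀ w, w = v₀) ∧ G.Sigma = {ℓ}) ∧
      RankStatementsHold Ω ∧ SturdyCoverHolds Ω ∧ UnrVertAbOfRankHolds Ω ∧
      UnrVerticialCharacterizationHolds' Ω ∧ VertCountLeNodeCountSuccHolds Ω ∧ VertexSetCharacterizationHolds Ω ∧
      SeparatingCoveringsHolds Ω ∧ CommensurableTerminalityHolds Ω ∧ OpenInterDeterminesComponentHolds Ω ∧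
      EdgeLikeIncidenceHolds Ω ∧ UnrVerticialIffHolds Ω ∧ GraphicIffEdgeLikeVerticialHolds Ω ∧
      CuspidalEdgeLikeCharacterizationHolds Ω ∧ NumericallyCuspidalIffHolds Ω ∧
      -- the tree's Thm. 1.6 (iii) DERIVATION, all its origin-level inputs now proved at `Ω`
      (∀ ⦃Q : Type⦄ [Group Q] [TopologicalSpace Q] [IsTopologicalGroup Q]
        ⦃Q' : Type⦄ [Group Q'] [TopologicalSpace Q'] [IsTopologicalGroup Q']
        {G : PSCDatum Q} {H : PSCDatum Q'}, Ω.IsOfPSCType G → Ω.IsOfPSCType H →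
        ∀ β : (Q ⧸ G.unrKer) ≃ₜ* (Q' ⧸ H.unrKer), G.UnrVerticiallyFiltrationPreservingIffVerticial H β) := by
  let Ω : PSCOrigin.{0} :=
    ⟨fun {Q} _ _ G => ∃ (_ : IsTopologicalGroup Q), CompactSpace Q ∧ T2Space Q ∧
      TotallyDisconnectedSpace Q ∧ IsEmpty G.graph.N ∧ (∀ v, G.vertGp v = ⊤) ∧
      (∃ v₀ : G.graph.V, ∀ w, w = v₀) ∧ G.Sigma = {ℓ} ∧
      ∃ (g r : ℕ) (ι : PuncturedSurfaceGroup g r →* Q) (e : G.graph.C ≃ Fin r),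
        IsHyperbolicType g r ∧ IsProSigmaCompletion G.Sigma ι ∧ (∀ v, G.genus v = g) ∧
        ∀ c, ∃ δ : ConjAct Q, G.cuspGp c = δ • ((cuspInertia (g := g) (e c)).map ι).topologicalClosure⟩
  have hΩ₁ : ∀ ⦃Q : Type⦄ [Group Q] [TopologicalSpace Q] [IsTopologicalGroup Q] (G : PSCDatum Q),
      Ω.IsOfPSCType G → CompactSpace Q ∧ T2Space Q ∧ TotallyDisconnectedSpace Q ∧ IsEmpty G.graph.N ∧
        (∀ v, G.vertGp v = ⊤) ∧ (∃ v₀ : G.graph.V, ∀ w, w = v₀) ∧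
        ∃ (S : Set ℕ) (g r : ℕ) (ι : PuncturedSurfaceGroup g r →* Q) (e : G.graph.C ≃ Fin r),
          S.Nonempty ∧ (∀ p ∈ S, p.Prime) ∧ IsHyperbolicType g r ∧ IsProSigmaCompletion S ι ∧
          ∀ c, ∃ δ : ConjAct Q, G.cuspGp c =
            δ • ((cuspInertia (g := g) (e c)).map ι).topologicalClosure := by
    intro Q _ _ _ G hG
    obtain ⟨_, hc, ht, hd, hN, hV, hv, -, g, r, ι, e, hgr, hι, -, hC⟩ := hG
    exact ⟨hc, ht, hd, hN, hV, hv, G.Sigma, g, r, ι, e, G.sigma_nonempty, G.sigma_prime, hgr, hι, hC⟩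
  have hΩ₁' : ∀ ⦃Q : Type⦄ [Group Q] [TopologicalSpace Q] [IsTopologicalGroup Q] (G : PSCDatum Q),
      Ω.IsOfPSCType G → CompactSpace Q ∧ T2Space Q ∧ TotallyDisconnectedSpace Q ∧ IsEmpty G.graph.N ∧
        (∃ v₀ : G.graph.V, ∀ w, w = v₀) ∧
        ∃ (S : Set ℕ) (g r : ℕ) (ι : PuncturedSurfaceGroup g r →* Q) (e : G.graph.C ≃ Fin r),
          S.Nonempty ∧ (∀ p ∈ S, p.Prime) ∧ IsHyperbolicType g r ∧ IsProSigmaCompletion S ι ∧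
          ∀ c, ∃ δ : ConjAct Q, G.cuspGp c =
            δ • ((cuspInertia (g := g) (e c)).map ι).topologicalClosure := fun Q _ _ _ G hG => by
    obtain ⟨h1, h2, h3, h4, -, h6, h7⟩ := hΩ₁ G hG
    exact ⟨h1, h2, h3, h4, h6, h7⟩
  have hΩ₂ : ∀ ⦃Q : Type⦄ [Group Q] [TopologicalSpace Q] (G : PSCDatum Q), Ω.IsOfPSCType G →
      IsEmpty G.graph.N ∧ (∀ v, G.vertGp v = ⊤) ∧ Nonempty G.graph.V := by
    intro Q _ _ G hG
    obtain ⟨_, -, -, -, hN, hV, ⟨v₀, -⟩, -⟩ := hG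
    exact ⟨hN, hV, ⟨v₀⟩⟩
  have hΩv : ∀ ⦃Q : Type⦄ [Group Q] [TopologicalSpace Q] (G : PSCDatum Q), Ω.IsOfPSCType G →
      (∀ v, G.vertGp v = ⊤) ∧ ∃ v₀ : G.graph.V, ∀ w, w = v₀ := by
    intro Q _ _ G hG
    obtain ⟨_, -, -, -, -, hV, hv, -⟩ := hG
    exact ⟨hV, hv⟩
  have hSig : ∀ ⦃Q : Type⦄ [Group Q] [TopologicalSpace Q] [IsTopologicalGroup Q] (G : PSCDatum Q),
      Ω.IsOfPSCType G → G.Sigma = {ℓ} := by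
    intro Q _ _ _ G hG
    obtain ⟨_, -, -, -, -, -, -, hS, -⟩ := hG
    exact hS
  have hprof : ∀ ⦃Q : Type⦄ [Group Q] [TopologicalSpace Q] [IsTopologicalGroup Q] (G : PSCDatum Q),
      Ω.IsOfPSCType G → CompactSpace Q ∧ T2Space Q ∧ TotallyDisconnectedSpace Q ∧ IsEmpty G.graph.N ∧
        (∀ v, G.vertGp v = ⊤) ∧ (∃ v₀ : G.graph.V, ∀ w, w = v₀) ∧ G.Sigma = {ℓ} := by
    intro Q _ _ _ H hH
    obtain ⟨_, hc, ht, hd, hN, hV, hv, hS, -⟩ := hH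
    exact ⟨hc, ht, hd, hN, hV, hv, hS⟩
  have hrank : UnrVertAbOfRankHolds Ω :=
    unrVertAbOfRankHolds_of_smoothCurveGenuine Ω fun Q _ _ _ G hG => by
      obtain ⟨_, -, ht, -, hN, hV, -, -, g, r, ι, e, -, hι, hgen, hC⟩ := hG
      exact ⟨ht, hN, hV, g, r, ι, e, hι, hgen, hC⟩
  have hunr : UnrVerticialCharacterizationHolds' Ω := unrVerticialCharacterizationHolds'_of_vertGp_eq_top Ω hΩv
  have hsturdy : SturdyCoverHolds Ω :=
    sturdyCoverHolds_of_smoothCurveGenuine_singleton Ω fun Q _ _ _ G hG => by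
      obtain ⟨_, hc, ht, hd, hN, hV, hv, hS, g, r, ι, e, hgr, hι, hgen, hC⟩ := hG
      exact ⟨hc, ht, hd, hN, hV, hv, ⟨ℓ, hℓ, hS⟩, g, r, ι, e, hgr, hι, hgen, hC⟩
  have hrs : RankStatementsHold Ω :=
    rankStatementsHold_of_smoothCurveGenuine Ω fun Q _ _ _ G hG => by
      obtain ⟨_, hc, ht, hd, hN, hV, hv, -, g, r, ι, e, hgr, hι, hgen, hC⟩ := hG
      exact ⟨hc, ht, hd, hN, hV, hv, g, r, ι, e, hgr, hι, hgen, hC⟩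
  have hconn : VertCountLeNodeCountSuccHolds Ω := vertCountLeNodeCountSuccHolds_of_vertGp_eq_top Ω hΩv
  have hres : RestrictBDOfPSCTypeHolds Ω := by
    intro Q _ _ _ H hH
    obtain ⟨_, hc, ht, hd, hN, hV, ⟨v₀, hv⟩, hS, g, r, ι, e, hgr, hι, hgen, hC⟩ := hH
    refine ⟨H.chosenBranchData, fun U _ hU => ?_⟩
    rw [restrictBD_chosen]
    haveI : CompactSpace U := isCompact_iff_compactSpace.mp (U.isClosed_of_isOpen hU).isCompact
    obtain ⟨hN', hV', hv', g', r', ι', e', h', hι', -, hgen', hC'⟩ :=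
      H.restrict_smoothCurveGenuine U hU hV v₀ hv hgr ι hι e hC hgen
    exact ⟨inferInstance, inferInstance, inferInstance, inferInstance, hN', hV', hv', hS, g', r', ι', e', h',
      hι', hgen', hC'⟩
  refine ⟨Ω, fun g r hgr => ?_, hres, hprof, hrs, hsturdy, hrank, hunr, hconn,
    vertexSetCharacterizationHolds_of_profiniteOrigin' Ω (fun Q _ _ G hG => ?_) hunr hrank, ?_,
    commensurableTerminalityHolds_of_smoothCurve' Ω hΩ₁,
    openInterDeterminesComponentHolds_of_smoothCurve' Ω hΩ₁',
    edgeLikeIncidenceHolds_of_vertGp_eq_top Ω hΩ₂,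
    unrVerticialIffHolds_of_vertGp_eq_top Ω (fun Q _ _ G hG => ⟨(hΩ₂ G hG).2.1, (hΩ₂ G hG).2.2⟩),
    graphicIffEdgeLikeVerticialHolds_of_smoothCurve' Ω hΩ₁ hΩ₂,
    cuspidalEdgeLikeCharacterizationHolds_of_smoothCurve' Ω hΩ₁',
    numericallyCuspidalIffHolds_of_smoothCurve' Ω ℓ hΩ₁' hSig,
    fun Q _ _ _ Q' _ _ _ G H hG hH β =>
      unrVerticialIff_holds_of_inputs' Ω (fun _ _ _ _ K hK => ⟨(hprof K hK).1, (hprof K hK).2.2.1⟩) hrs hconn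
        hunr hrank hres hG hH (hSig G hG) (hSig H hH) β⟩
  · -- inhabitation: the pro-`ℓ` smooth curve of type `(g, r)`
    obtain ⟨Q, η, hη⟩ := exists_isProSigmaCompletion (PuncturedSurfaceGroup g r) ({ℓ} : Set ℕ)
    let T : PSCDatum Q :=
      { Sigma := {ℓ}
        sigma_prime := fun p hp => by rw [Set.mem_singleton_iff.mp hp]; exact hℓ
        sigma_nonempty := ⟨ℓ, Set.mem_singleton ℓ⟩
        graph := { V := Unit, N := Empty, C := Fin r, nodeEnds := Empty.elim, cuspEnd := fun _ => () }
        vertGp := fun _ => ⊤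
        nodeGp := Empty.elim
        cuspGp := fun i => ((cuspInertia (g := g) i).map η).topologicalClosure
        genus := fun _ => g
        isClosed_vertGp := fun _ => by rw [Subgroup.coe_top]; exact isClosed_univ
        isClosed_nodeGp := fun e => e.elim
        isClosed_cuspGp := fun _ => Subgroup.isClosed_topologicalClosure _
        nodeGp_le := fun e => e.elim
        cuspGp_le := fun _ => ⟨1, le_top⟩
        proSigma := isProSigma_of_isProSigmaCompletion hη }
    have hT : Ω.IsOfPSCType T :=
      ⟨inferInstance, inferInstance, inferInstance, inferInstance, inferInstanceAs (IsEmpty Empty),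
        fun _ => rfl, ⟨(), fun _ => rfl⟩, rfl, g, r, η, Equiv.refl _, hgr, hη, fun _ => rfl,
        fun c => ⟨1, by rw [one_smul]; rfl⟩⟩
    exact ⟨Q, η, T, hη, hT, rfl, rfl, rfl, Fintype.card_fin r, fun _ => ⟨rfl, rfl⟩, Equiv.refl _,
      fun _ => rfl⟩
  · obtain ⟨_, hc, ht, hd, -⟩ := hG
    exact ⟨hc, ht, hd⟩
  · -- F-2830: abc-iut-f-166's separating coverings under the relaxed cusp clause
    intro Q _ _ _ G hG
    obtain ⟨_, hc, ht, hd, hN, hV, ⟨v₀, hv⟩, -, g, r, ι, e, hgr, hι, -, hC⟩ := hG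
    exact G.separatingCoverings_of_smoothCurve' G.sigma_nonempty G.sigma_prime hgr ι hι e
      (fun c => (hC c).elim fun δ h => ⟨ConjAct.ofConjAct δ, by rwa [ConjAct.toConjAct_ofConjAct]⟩)
      hV v₀ hv


end PSCDatum

end Literature.AnabelianGeometry.SemiGraphs

end
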